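import Summits.CriticalPhenomena.PercolationContinuityZ3.Theorems.PercNearOneGluingNoHeavyLowerTailMergeGainTools
import Literature.Probability.LatticeModels.ProdBernoulliIndependence
import HarnessLib

/-!
# `NoHeavyLowerTail` (stmt-CriticalPhenomena-4575) — Kozma–Nitzan's gluing lemma for a relay carrying a unit with an
# ARBITRARY law ("Lemma 5 for general-law units")

Support file (lemma factory `prim-lf-3` gen 7, seat g9; `--supports stmt-CriticalPhenomena-4575`).  No definitions, no
named facts, no sorries.  Memo: `run/shared/lean/prim/prim-lf-3/LF3-BETA-R.md` §7.

A UNIT attached to the observer glues a random set of relays `S` drawn from a finite family `𝒮` with arbitrary nonnegative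
weights `ν S` (not a product law, not normalised).  In the split world the unit acts alone: reliabilities under `glue_S w`
(`S` a clique); after gluing the unit INTO the relay `c` they are read under `glue_S w` with the extra pair `s(c, s₀(S))` set to `1`
(`s₀(S) ∈ S` any chosen member; connectivity-wise this is `glue_{S ∪ {c}} w`, see `real_openConn_glue_insert`).

* `unitGlue_general`:   Σ_S ν_S·[(c − j)_{glue_S w}] ≥ 0   ⟹   Σ_S ν_S·[(c − j)_{glue_S w + s(c,s₀ S) ↦ 1}] ≥ 0.
  (A weight-one pair is a.s. open: `prodBernoulli_real_setOf_notMem`, cf. `TwoPortPeeling.real_notMem_eq_zero_of_one`.)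
  Proof (memo §7, two lines): if `μ_w(c↔b) ≤ μ_w(j↔b)`, the ANCHORED EXCHANGE (`anchoredExchange`, ranked in `w`) and
  `mergeGain_ge` give term by term `(c−j)_{after} ≥ (c−j)_{before}`; if `μ_w(j↔b) ≤ μ_w(c↔b)`, Lemma 5 (`hubExchange_union` for the
  block `S ∪ {c}` ∋ `c`, then `real_openConn_glue_insert`) gives `(c−j)_{after} ≥ 0` term by term, and the hypothesis is not needed.
  (`twoAtomGlue` is the case `𝒮 = {∅, P}`; by Farkas duality this is the 'two-pattern inequality' of the memo.)
* `real_openConn_glue_insert` — `μ_{glue_{S∪{c}} w}(z↔b) = μ_{glue_S w + s(c,s₀)↦1}(z↔b)`: once `c` hangs on `s₀ ∈ S` and `S` is a sure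
  clique, the further pairs `c–s` do not change connectivity (push-forward `ω ↦ ω ∪ D`, null set of a closed weight-1 pair).
-/

namespace Summit.CriticalPhenomena.PercolationContinuityZ3.Theorems

open MeasureTheory Set ProbabilityTheory
open Literature.Probability.LatticeModels
open Literature.Probability.Percolation

noncomputable section
open Classical

namespace UpsetExchange

variable {n : ℕ}

/-- Adding pairs whose endpoints are already joined does not create new connections. [folklore] -/
theorem reachable_of_union_joined (ω : BondConfig (Fin n)) (D : Finset (Sym2 (Fin n))) (z b : Fin n)
    (hD : ∀ e ∈ D, ∀ x ∈ e, ∀ y ∈ e, (openGraph ω).Reachable x y)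
    (h : (openGraph ((ω ∪ (↑D : Set (Sym2 (Fin n))) : Set (Sym2 (Fin n))) : BondConfig (Fin n))).Reachable z b) :
    (openGraph ω).Reachable z b := by
  induction D using Finset.induction_on generalizing z b with
  | empty => simpa using h
  | insert e D' he ih =>
    have hD' : ∀ e ∈ D', ∀ x ∈ e, ∀ y ∈ e, (openGraph ω).Reachable x y :=
      fun f hf => hD f (Finset.mem_insert_of_mem hf)
    have hmono : ∀ {x y : Fin n}, (openGraph ω).Reachable x y →
        (openGraph ((ω ∪ (↑D' : Set (Sym2 (Fin n))) : Set (Sym2 (Fin n))) : BondConfig (Fin n))).Reachable x y :=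
      fun hr => hr.mono (openGraph_mono subset_union_left)
    induction e using Sym2.ind with
    | h x y =>
      have hxy : (openGraph ω).Reachable x y :=
        hD _ (Finset.mem_insert_self _ _) x (Sym2.mem_mk_left x y) y (Sym2.mem_mk_right x y)
      have hset : (ω ∪ (↑(insert s(x, y) D') : Set (Sym2 (Fin n))) : Set (Sym2 (Fin n))) =
          (ω ∪ (↑D' : Set (Sym2 (Fin n)))) ∪ {s(x, y)} := by
        ext f
        simp only [Finset.coe_insert, mem_union, mem_insert_iff, Finset.mem_coe, mem_singleton_iff]
        tauto
      rw [hset] at h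
      rcases WeakestPort.reachable_union_pair h with h1 | ⟨h2, h3⟩ | ⟨h2, h3⟩
      · exact ih z b hD' h1
      · exact ih z b hD' ((h2.trans (hmono hxy)).trans h3)
      · exact ih z b hD' ((h2.trans (hmono hxy.symm)).trans h3)

/-- **Clique gluing of `S ∪ {c}` versus one extra pair.**  `c ∉ S`, `s₀ ∈ S`: for every `z, b`,
`μ_{glue_{S∪{c}} w}(z ↔ b) = μ_{glue_S w + s(c,s₀) ↦ 1}(z ↔ b)`. [folklore] -/
theorem real_openConn_glue_insert (w : Sym2 (Fin n) → unitInterval) (S : Finset (Fin n)) (c s₀ : Fin n)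
    (hs₀ : s₀ ∈ S) (hcS : c ∉ S) (z b : Fin n) :
    (prodBernoulli (fun e : Sym2 (Fin n) => if (∀ x ∈ e, x ∈ insert c S) ∧ ¬ e.IsDiag then 1 else w e)).real (openConn z b) =
      (prodBernoulli (fun f : Sym2 (Fin n) => if f = s(c, s₀) then 1 else
          (if (∀ x ∈ f, x ∈ S) ∧ ¬ f.IsDiag then 1 else w f))).real (openConn z b) := by
  set g : Sym2 (Fin n) → unitInterval := fun e => if (∀ x ∈ e, x ∈ S) ∧ ¬ e.IsDiag then 1 else w e with hg
  set g₁ : Sym2 (Fin n) → unitInterval := fun f => if f = s(c, s₀) then 1 else g f with hg₁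
  set g₂ : Sym2 (Fin n) → unitInterval := fun e => if (∀ x ∈ e, x ∈ insert c S) ∧ ¬ e.IsDiag then 1 else w e with hg₂
  have hcs₀ : c ≠ s₀ := fun h => hcS (h ▸ hs₀)
  -- the pairs from `c` to `S`
  set D : Finset (Sym2 (Fin n)) := S.image (fun t => s(c, t)) with hD
  have hDmem : ∀ e, e ∈ D ↔ ∃ t ∈ S, e = s(c, t) := by
    intro e; simp only [hD, Finset.mem_image]; constructor
    · rintro ⟨t, ht, rfl⟩; exact ⟨t, ht, rfl⟩
    · rintro ⟨t, ht, rfl⟩; exact ⟨t, ht, rfl⟩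
  -- `g₂` is `g₁` with `D` glued
  have hpush : ∀ X : Set (BondConfig (Fin n)), (prodBernoulli g₂).real X =
      (prodBernoulli g₁).real {ω | ((ω ∪ (↑D : Set (Sym2 (Fin n))) : Set (Sym2 (Fin n))) : BondConfig (Fin n)) ∈ X} := by
    intro X
    refine glueSet_pushforward g₁ g₂ (↑D) (fun f hf => ?_) (fun f hf => ?_) X
    · obtain ⟨t, ht, rfl⟩ := (hDmem f).1 (Finset.mem_coe.1 hf)
      have hne : c ≠ t := fun h => hcS (h ▸ ht)
      have : (∀ x ∈ s(c, t), x ∈ insert c S) ∧ ¬ (s(c, t)).IsDiag := by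
        refine ⟨fun x hx => ?_, by rw [Sym2.mk_isDiag_iff]; exact hne⟩
        rcases Sym2.mem_iff.1 hx with rfl | rfl
        · exact Finset.mem_insert_self _ _
        · exact Finset.mem_insert_of_mem ht
      simp only [hg₂, if_pos this]
    · have hf' : ¬ ∃ t ∈ S, f = s(c, t) := fun h => hf (Finset.mem_coe.2 ((hDmem f).2 h))
      have hne : f ≠ s(c, s₀) := fun h => hf' ⟨s₀, hs₀, h⟩
      simp only [hg₂, hg₁, hg, if_neg hne]
      by_cases hin : (∀ x ∈ f, x ∈ S) ∧ ¬ f.IsDiag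
      · have : (∀ x ∈ f, x ∈ insert c S) ∧ ¬ f.IsDiag := ⟨fun x hx => Finset.mem_insert_of_mem (hin.1 x hx), hin.2⟩
        rw [if_pos this, if_pos hin]
      · rw [if_neg hin]
        by_cases hin2 : (∀ x ∈ f, x ∈ insert c S) ∧ ¬ f.IsDiag
        · exfalso
          -- then `f` meets `c` and `S`, so `f = s(c,s)` for some `s ∈ S`, or lies inside `S`
          obtain ⟨h1, h2⟩ := hin2
          induction f using Sym2.ind with
          | h x y =>
            have hx := h1 x (Sym2.mem_mk_left x y)
            have hy := h1 y (Sym2.mem_mk_right x y)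
            rw [Finset.mem_insert] at hx hy
            rw [Sym2.mk_isDiag_iff] at h2
            rcases hx with rfl | hx
            · rcases hy with rfl | hy
              · exact h2 rfl
              · exact hf' ⟨y, hy, rfl⟩
            · rcases hy with rfl | hy
              · exact hf' ⟨x, hx, Sym2.eq_swap⟩
              · exact hin ⟨fun v hv => by rcases Sym2.mem_iff.1 hv with rfl | rfl <;> assumption, by rw [Sym2.mk_isDiag_iff]; exact h2⟩
        · rw [if_neg hin2]
  rw [hpush]
  -- the event differs from `openConn z b` only on a null set
  set A : Set (BondConfig (Fin n)) := {ω | ((ω ∪ (↑D : Set (Sym2 (Fin n))) : Set (Sym2 (Fin n))) : BondConfig (Fin n)) ∈ (openConn z b : Set _)} with hA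
  set E : Finset (Sym2 (Fin n)) := insert s(c, s₀) (Finset.univ.filter (fun e => (∀ x ∈ e, x ∈ S) ∧ ¬ e.IsDiag)) with hE
  have hsub1 : (openConn z b : Set (BondConfig (Fin n))) ⊆ A := by
    intro ω hω
    exact (hω : (openGraph ω).Reachable z b).mono (openGraph_mono subset_union_left)
  have hsub2 : A ⊆ openConn z b ∪ ⋃ e ∈ E, {ω : BondConfig (Fin n) | e ∉ ω} := by
    intro ω hω
    by_cases hall : ∀ e ∈ E, e ∈ ω
    · left
      -- all of `S ∪ {c}` is joined in `ω` through `s₀`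
      have hcs : (openGraph ω).Reachable c s₀ :=
        ((openGraph_adj ω c s₀).2 ⟨hall _ (Finset.mem_insert_self _ _), hcs₀⟩).reachable
      have hSS : ∀ t ∈ S, (openGraph ω).Reachable s₀ t := by
        intro t ht
        by_cases h : s₀ = t
        · rw [h]
        · have hmem : s(s₀, t) ∈ E := by
            refine Finset.mem_insert_of_mem (Finset.mem_filter.2 ⟨Finset.mem_univ _, ?_, ?_⟩)
            · intro x hx; rcases Sym2.mem_iff.1 hx with rfl | rfl <;> assumption
            · rw [Sym2.mk_isDiag_iff]; exact h
          exact ((openGraph_adj ω s₀ t).2 ⟨hall _ hmem, h⟩).reachable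
      refine reachable_of_union_joined ω D z b (fun e he x hx y hy => ?_) hω
      obtain ⟨t, ht, rfl⟩ := (hDmem e).1 he
      have hct : (openGraph ω).Reachable c t := hcs.trans (hSS t ht)
      have hcx : ∀ v ∈ s(c, t), (openGraph ω).Reachable c v := by
        intro v hv
        rcases Sym2.mem_iff.1 hv with hv' | hv' <;> rw [hv']
        exact hct
      exact (hcx x hx).symm.trans (hcx y hy)
    · right
      push Not at hall
      obtain ⟨e, he, hne⟩ := hall
      exact mem_iUnion₂.2 ⟨e, he, hne⟩
  have hnull : (prodBernoulli g₁).real (⋃ e ∈ E, {ω : BondConfig (Fin n) | e ∉ ω}) = 0 := by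
    apply le_antisymm _ measureReal_nonneg
    refine (measureReal_biUnion_finset_le E _).trans (le_of_eq ?_)
    refine Finset.sum_eq_zero fun e he => ?_
    rw [prodBernoulli_real_setOf_notMem g₁ e]
    suffices hge : g₁ e = 1 by rw [hge]; simp
    rw [hE, Finset.mem_insert, Finset.mem_filter] at he
    rcases he with rfl | ⟨-, he⟩
    · simp [hg₁]
    · simp only [hg₁, hg, if_pos he]
      split <;> rfl
  apply le_antisymm
  · calc (prodBernoulli g₁).real A ≤ (prodBernoulli g₁).real (openConn z b ∪ ⋃ e ∈ E, {ω : BondConfig (Fin n) | e ∉ ω}) :=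
          measureReal_mono hsub2 (measure_ne_top _ _)
      _ ≤ (prodBernoulli g₁).real (openConn z b) + (prodBernoulli g₁).real (⋃ e ∈ E, {ω : BondConfig (Fin n) | e ∉ ω}) :=
          measureReal_union_le _ _
      _ = (prodBernoulli g₁).real (openConn z b) := by rw [hnull, add_zero]
  · exact measureReal_mono hsub1 (measure_ne_top _ _)

/-- **Lemma 5 for a general-law unit.**  See the module docstring.
[cite: KozmaNitzan2024, Lemma 5 and Lemma 3(i) (pp. 6, 13); VandenbergHaggstromKahn2005, Thm. 1.2] -/
theorem unitGlue_general (w : Sym2 (Fin n) → unitInterval) (c j b : Fin n) (𝒮 : Finset (Finset (Fin n)))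
    (ν : Finset (Fin n) → ℝ) (hν : ∀ S ∈ 𝒮, 0 ≤ ν S) (hcS : ∀ S ∈ 𝒮, c ∉ S)
    (s₀ : Finset (Fin n) → Fin n) (hs₀ : ∀ S ∈ 𝒮, S.Nonempty → s₀ S ∈ S)
    (hyp : 0 ≤ ∑ S ∈ 𝒮, ν S *
      ((prodBernoulli (fun e : Sym2 (Fin n) => if (∀ x ∈ e, x ∈ S) ∧ ¬ e.IsDiag then 1 else w e)).real (openConn c b) -
        (prodBernoulli (fun e : Sym2 (Fin n) => if (∀ x ∈ e, x ∈ S) ∧ ¬ e.IsDiag then 1 else w e)).real (openConn j b))) :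
    0 ≤ ∑ S ∈ 𝒮, ν S *
      ((prodBernoulli (fun e : Sym2 (Fin n) => if (∀ x ∈ e, x ∈ insert c S) ∧ ¬ e.IsDiag then 1 else w e)).real (openConn c b) -
        (prodBernoulli (fun e : Sym2 (Fin n) => if (∀ x ∈ e, x ∈ insert c S) ∧ ¬ e.IsDiag then 1 else w e)).real (openConn j b)) := by
  by_cases hcj : (prodBernoulli w).real (openConn j b) ≤ (prodBernoulli w).real (openConn c b)
  · -- Lemma 5 term by term (hypothesis not needed)
    refine Finset.sum_nonneg fun S hS => mul_nonneg (hν S hS) ?_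
    have hx := hubExchange_union w (insert c S) j b c (Finset.mem_insert_self _ _) ({∅} : Finset (Finset (Sym2 (Fin n))))
      (by simp) hcj
    have hU : {ω : BondConfig (Fin n) | ∃ C ∈ ({∅} : Finset (Finset (Sym2 (Fin n)))), (↑C : Set (Sym2 (Fin n))) ⊆ ω} = univ := by
      ext ω; simp
    rw [hU, inter_univ, inter_univ] at hx
    linarith
  · -- anchored exchange term by term: (c−j) after ≥ (c−j) before
    have hle : (prodBernoulli w).real (openConn c b) ≤ (prodBernoulli w).real (openConn j b) := le_of_lt (lt_of_not_ge hcj)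
    refine le_trans hyp (Finset.sum_le_sum fun S hS => mul_le_mul_of_nonneg_left ?_ (hν S hS))
    set g : Sym2 (Fin n) → unitInterval := fun e => if (∀ x ∈ e, x ∈ S) ∧ ¬ e.IsDiag then 1 else w e with hg
    rcases S.eq_empty_or_nonempty with hSe | hSne
    · -- empty unit pattern: gluing `{c}` changes nothing
      have h1 : (fun e : Sym2 (Fin n) => if (∀ x ∈ e, x ∈ insert c S) ∧ ¬ e.IsDiag then (1 : unitInterval) else w e) = w := by
        funext f
        by_cases hf : (∀ x ∈ f, x ∈ insert c S) ∧ ¬ f.IsDiag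
        · exfalso
          obtain ⟨h1', h2'⟩ := hf
          induction f using Sym2.ind with
          | h x y =>
            have hx := h1' x (Sym2.mem_mk_left x y)
            have hy := h1' y (Sym2.mem_mk_right x y)
            rw [hSe, Finset.mem_insert] at hx hy
            simp only [Finset.notMem_empty, or_false] at hx hy
            exact h2' (by rw [Sym2.mk_isDiag_iff, hx, hy])
        · rw [if_neg hf]
      have h2 : g = w := by
        funext f
        by_cases hf : (∀ x ∈ f, x ∈ S) ∧ ¬ f.IsDiag
        · exfalso
          obtain ⟨h1', h2'⟩ := hf
          induction f using Sym2.ind with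
          | h x y => exact absurd (h1' x (Sym2.mem_mk_left x y)) (by rw [hSe]; simp)
        · simp only [hg, if_neg hf]
      rw [h1, h2]
    · have hs := hs₀ S hS hSne
      have hc := hcS S hS
      have hcs : c ≠ s₀ S := fun h => hc (h ▸ hs)
      rw [real_openConn_glue_insert w S c (s₀ S) hs hc c b, real_openConn_glue_insert w S c (s₀ S) hs hc j b]
      have hx := anchoredExchange w S c j b (s₀ S) hs hle
      have hm := mergeGain_ge g hcs j b
      change (prodBernoulli g).real (openConn c b) - (prodBernoulli g).real (openConn j b) ≤
        (prodBernoulli (fun f : Sym2 (Fin n) => if f = s(c, s₀ S) then 1 else g f)).real (openConn c b) -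
          (prodBernoulli (fun f : Sym2 (Fin n) => if f = s(c, s₀ S) then 1 else g f)).real (openConn j b)
      linarith

end UpsetExchange

end

end Summit.CriticalPhenomena.PercolationContinuityZ3.Theorems
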